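import Literature.AlgebraicGeometry.Resolution.ProperModelsPatching
import Mathlib.AlgebraicGeometry.PullbackCarrier
import HarnessLib

/-!
# RegLe-ification of a morphism of proper models from a local RegLe-ification

Topic: `Literature/AlgebraicGeometry/Resolution`. The bookkeeping step of Zariski's two-model
patching for PROPER models (Piltant 2013, proof of Prop. 5.1, Step 5: the glued scheme is
compactified to a proper model) that turns a LOCAL RegLe-ification of a morphism `φ : M → Y` of
proper models of `K/k` (`ProperModel.LocalRegLeification`, `ProperModelsPatching.lean`: an open
`O ⊆ M` containing `Reg M` and `φ⁻¹(Reg Y)`, an integral scheme `N` and a proper birational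
`ρ : N → O` whose points over `Reg M`, resp. over `φ⁻¹(Reg Y)`, are regular) into a
RegLe-ification (`ProperModel.RegLeification`: a morphism of proper models `ψ : M' → M` with
`ψ⁻¹(Reg M) ⊆ Reg M'` and `(φ ∘ ψ)⁻¹(Reg Y) ⊆ Reg M'`), GIVEN an extension of `ρ` to a morphism
of proper models `ψ : P' → M` together with an open immersion `i : N → P'.X` making
`N = P' ×_M O` a cartesian square (such an extension is supplied by a Nagata compactification of
`N → M`; here it is a hypothesis).

* `isRegularLocalRing_stalk_of_isPullback_ι` — pure scheme theory: if `i : N → P` is an open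
  immersion and `IsPullback i ρ f O.ι` (`N = P ×_M O` for `f : P → M`, `O ⊆ M` open), `S ⊆ O`,
  and every point of `N` lying over `S` is regular, then every point of `P` lying over `S` is
  regular (points of `P` over `O` lift to `N` by surjectivity of the comparison map to the
  topological fibre product, `Scheme.exists_preimage_of_isPullback`, and stalks along an open
  immersion are isomorphic).
* `ProperModel.Hom.regLe_of_isPullback` — for `φ : M → Y`, data `(O, N, ρ)` as in
  `LocalRegLeification` and `(P', ψ, i)` as above: `ψ.RegLe ∧ (ψ.comp φ).RegLe`.
* `ProperModel.regLeification_of_local` — `LocalRegLeification p → RegLeification p`, given the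
  extension property of proper birational modifications over opens of proper models.

## References

* O. Piltant, *An axiomatic version of Zariski's patching theorem*, RACSAM 107 (2013) 91–121,
  proof of Prop. 5.1, Step 5. [Piltant2013]
* O. Zariski, P. Samuel, *Commutative Algebra* II, Ch. VI §17. [ZariskiSamuel1960]
-/

noncomputable section

open CategoryTheory AlgebraicGeometry

namespace Literature.AlgebraicGeometry.Resolution

universe u

/-- **Regularity over `S ⊆ O` transfers from `N = P ×_M O` to `P`.** If `i : N → P` is an open
immersion, `IsPullback i ρ f O.ι` for `f : P → M` and an open `O ⊆ M`, `S ⊆ O`, and the stalk of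
`N` at every point lying over `S` is regular, then the stalk of `P` at every point `y` with
`f y ∈ S` is regular: `y` lifts to `n ∈ N` with `i n = y` (`Scheme.exists_preimage_of_isPullback`)
and `𝒪_{P,y} ≅ 𝒪_{N,n}` along the open immersion `i`. [folklore] -/
theorem isRegularLocalRing_stalk_of_isPullback_ι {N P M : Scheme.{u}} {O : M.Opens}
    {i : N ⟶ P} {ρ : N ⟶ (O : Scheme.{u})} {f : P ⟶ M} [IsOpenImmersion i]
    (hsq : IsPullback i ρ f O.ι) {S : Set M} (hS : S ⊆ (O : Set M))
    (hN : ∀ n : N, (ρ n).1 ∈ S → IsRegularLocalRing (N.presheaf.stalk n))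
    (y : P) (hy : f y ∈ S) : IsRegularLocalRing (P.presheaf.stalk y) := by
  obtain ⟨n, hn₁, hn₂⟩ :=
    Scheme.exists_preimage_of_isPullback hsq y (⟨f y, hS hy⟩ : O) rfl
  have hreg : IsRegularLocalRing (N.presheaf.stalk n) := hN n (by rw [hn₂]; exact hy)
  rw [← hn₁]
  exact IsRegularLocalRing.of_ringEquiv (asIso (i.stalkMap n)).commRingCatIsoToRingEquiv.symm

namespace ProperModel

variable {k K : Type u} [Field k] [Field K] [Algebra k K]

/-- **Compactifying a local RegLe-ification** (Piltant 2013, proof of Prop. 5.1, Step 5, the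
bookkeeping): let `φ : M → Y` be a morphism of proper models of `K/k`, `O ⊆ M` an open containing
every regular point of `M` and every point over a regular point of `Y`, `ρ : N → O` with every
point of `N` over `Reg M`, resp. over `φ⁻¹(Reg Y)`, regular, and let `ψ : P' → M` be a morphism
of proper models with an open immersion `i : N → P'.X` such that `N = P' ×_M O`
(`IsPullback i ρ ψ.f O.ι`). Then `ψ⁻¹(Reg M) ⊆ Reg P'` and `(φ ∘ ψ)⁻¹(Reg Y) ⊆ Reg P'`.
[cite: Piltant2013, proof of Prop. 5.1, Step 5] -/
theorem Hom.regLe_of_isPullback {M Y P' : ProperModel k K} (φ : M.Hom Y) (O : M.X.Opens)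
    {N : Scheme.{u}} (ρ : N ⟶ (O : Scheme.{u}))
    (hO₁ : ∀ m : M.X, IsRegularLocalRing (M.X.presheaf.stalk m) → m ∈ O)
    (hO₂ : ∀ m : M.X, IsRegularLocalRing (Y.X.presheaf.stalk (φ.f m)) → m ∈ O)
    (hN₁ : ∀ n : N, IsRegularLocalRing (M.X.presheaf.stalk (ρ n).1) →
      IsRegularLocalRing (N.presheaf.stalk n))
    (hN₂ : ∀ n : N, IsRegularLocalRing (Y.X.presheaf.stalk (φ.f (ρ n).1)) →
      IsRegularLocalRing (N.presheaf.stalk n))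
    (ψ : P'.Hom M) (i : N ⟶ P'.X) [IsOpenImmersion i] (hsq : IsPullback i ρ ψ.f O.ι) :
    ψ.RegLe ∧ (ψ.comp φ).RegLe := by
  constructor
  · intro y hy
    exact isRegularLocalRing_stalk_of_isPullback_ι hsq
      (S := {m : M.X | IsRegularLocalRing (M.X.presheaf.stalk m)}) (fun m hm => hO₁ m hm)
      (fun n hn => hN₁ n hn) y hy
  · intro y hy
    rw [Hom.comp_f, Scheme.Hom.comp_apply] at hy
    exact isRegularLocalRing_stalk_of_isPullback_ι hsq
      (S := {m : M.X | IsRegularLocalRing (Y.X.presheaf.stalk (φ.f m))}) (fun m hm => hO₂ m hm)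
      (fun n hn => hN₂ n hn) y hy

/-- **RegLe-ification from local RegLe-ification and extension of proper modifications over
opens** (Piltant 2013, proof of Prop. 5.1, Step 5, for proper models): if every proper birational
integral `g : Y → U` over an open `U` of a proper model `P` of `K/k` extends to a morphism of
proper models `P' → P` with `P' ×_P U = Y` (a consequence of Nagata compactification), then
`LocalRegLeification p` implies `RegLeification p`. [cite: Piltant2013, proof of Prop. 5.1, Step 5] -/
theorem regLeification_of_local (p : ℕ)
    (hext : ∀ (k : Type u) [Field k] (K : Type u) [Field K] [Algebra k K] (P : ProperModel k K)
      (U : P.X.Opens) (Y : Scheme.{u}) [IsIntegral Y] (g : Y ⟶ (U : Scheme.{u})) [IsProper g],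
      IsBirational g →
        ∃ (P' : ProperModel k K) (φ : P'.Hom P) (i : Y ⟶ P'.X), IsOpenImmersion i ∧
          IsPullback i g φ.f U.ι)
    (hloc : LocalRegLeification.{u} p) : RegLeification.{u} p := by
  intro k _ _ K _ _ _ M Y φ
  obtain ⟨O, N, ρ, hN, hρ, hbir, hO₁, hO₂, hN₁, hN₂⟩ := hloc k K M Y φ
  haveI := hN
  haveI := hρ
  obtain ⟨P', ψ, i, hi, hsq⟩ := hext k K M O N ρ hbir
  haveI := hi
  exact ⟨P', ψ, Hom.regLe_of_isPullback φ O ρ hO₁ hO₂ hN₁ hN₂ ψ i hsq⟩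

end ProperModel

end Literature.AlgebraicGeometry.Resolution

end
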